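import Literature.Topology.FourManifolds.RadialExtension
import Literature.Topology.FourManifolds.DiscTheoremDiffeotopy
import Literature.Topology.FourManifolds.OrientedConnectedSumExistence
import Literature.Topology.FourManifolds.SmoothOrientationSphereProofs
import Literature.Topology.FourManifolds.EquidimensionalEmbedding
import Literature.Topology.FourManifolds.ConnectedSumData
import Literature.Topology.FourManifolds.ImmersionCriterion
import Literature.Topology.FourManifolds.ImmersionOrientation
import Literature.Topology.FourManifolds.FlatFaceModel
import HarnessLib

/-!
# Aligning a ball-with-face pair: model body onto an embedded ball, model face onto a disc

Topic `Literature/Topology/FourManifolds`; a plumbing brick for the fact seat of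
Alexander's theorem
(`provefact-Literature.Topology.FourManifolds.SphereEmbedding.schoenflies_exists_ball`,
Schultens, *Introduction to 3-Manifolds* (2014), Thm. 3.2.5).  **Everything in this file is
proved; no definitions, no named facts.**

In the region form of Alexander's induction (regions `A = {F ≤ 0} ⊂ ℝ³` bounded by the sphere,
moved by ambient diffeomorphisms: `SweepLemma.lean`, `FillLemma.lean`, `SweepBelowLevel.lean`,
`FillBelowLevel.lean`, `VerticaliseNearCorner.lean`) the step "`S₂` bounds a ball `B` by
induction; by Lemma 3.2.3, `S` is isotopic to `S₁`" (Schultens (2014), PDF p. 45) absorbs the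
ball `B` through the abstract sweep lemma `SmoothMax.exists_diffeomorph_image_sweep` with a sweep
function transported from the model body `M₀ = Ψ(𝔻³)` with flat face `F₀` of
`FlatFaceModel.lean`.  For this one needs a diffeomorphism `Θ` of `ℝ³` with `Θ(M₀) = B` carrying
the model face `F₀` **exactly** onto a prescribed disc `D ⊆ ∂B` (the lid of `B`): then the
transported model sweep function is `≡ 1` on `D`, its gradient is the outward conormal along
`D`, and the rest of `∂B` has the no-positive-conormal property of `FlatFaceModel.model_normal`.
This file constructs `Θ` from the induction hypothesis in its one-sided ball form
(`∃ e : ℝ³ → ℝ³` smooth embedding with `e(𝕊²) = S₂`, as consumed by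
`SphereEmbedding.schoenflies_exists_ball_of_euclidean`):

* `BallFaceAlignment.exists_diffeomorph_image_closedBall_eq` — **a smoothly embedded ball is
  the image of the round ball under a diffeomorphism of `ℝᵐ` diffeotopic to the identity**
  (disc theorem `exists_isDiffeotopicToId_apply_disc_eq` of `DiscTheoremDiffeotopy.lean` for
  the discs `id` and `e`, the latter precomposed with a reflection when it reverses
  orientation);
* `BallFaceAlignment.exists_diffeomorph_norm_eq_image_eq` — **two smooth discs
  `i, i' : ℝⁿ → 𝕊ⁿ` are interchanged (`i(𝔻ⁿ) ↦ i'(𝔻ⁿ)`) by a norm-preserving diffeomorphism of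
  `ℝⁿ⁺¹`**: the disc theorem in `𝕊ⁿ` and the radial extension of the resulting diffeotopy
  (`Diffeotopy.radialExtension`, `RadialExtension.lean`; Cerf 1968, Ch. I §1, Lemme 2);
* `BallFaceAlignment.exists_isSmoothEmbedding_image_eq_cap` — round caps
  `{x ∈ 𝕊ⁿ : ⟪u, x⟫ ≥ c₀}` are smooth discs (inverse stereographic chart at `u` and a homothety;
  `inner_chartAt_symm`: `⟪u, σᵤ⁻¹(z)⟫ = (4 - ‖z‖²)/(4 + ‖z‖²)`);
* `BallFaceAlignment.exists_lift_disc` — a disc `j : ℝⁿ → ℝⁿ⁺¹` lying on `Φ(𝕊ⁿ)` lifts through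
  the diffeomorphism `Φ` to a disc of Mathlib's manifold `𝕊ⁿ`;
* `BallFaceAlignment.exists_diffeomorph_image_model_eq` — **the pair diffeomorphism**: for a
  ball embedding `e`, a disc `j : ℝⁿ → ℝⁿ⁺¹` with `j(ℝⁿ) ⊆ e(𝕊ⁿ)`, any diffeomorphism `Ψ` and
  any round cap, some diffeomorphism `Θ` of `ℝⁿ⁺¹` has `Θ(Ψ(𝔻)) = e(𝔻)`, `Θ(Ψ(𝕊)) = e(𝕊)`,
  `Θ(Ψ(𝔹)) = e(𝔹)` and `Θ(Ψ(cap)) = j(𝔻ⁿ)`;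
* `BallFaceAlignment.image_cap_eq_face` — for the shear `Ψ` of `FlatFaceModel.exists_model` the
  image of the round cap `{⟪u, ·⟫ ≥ √(1 - r₀²)}` is the flat face
  `F₀ = {⟪u, x⟫ = √(1 - r₀²), ‖x‖² - ⟪u, x⟫² ≤ r₀²}`.

This is the smooth "standard model of a neighbourhood of the ball" invoked in the proof of
Schultens' Lemma 3.2.3 (2014, PDF pp. 42–43: the disc `D₁` is replaced by `D₂` across the ball
by straight-line projection in a standard model), with the face straightened as well.

Roadmap of this seat (for the neighbouring seat working on the same fact, whose
`SchoenfliesPlane.lean`, `PlaneLevelCircles.lean`, `SphereCircleSplitting.lean` supply the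
planar/level-circle bookkeeping): next come the capped-ball absorption itself (fill of an
exterior rim collar, transported sweep, one-sided re-sweep, doming), the recognition of the
one-saddle case by the exp-height function of index `≤ 1` (`HandlebodyBall.lean`), the
parametrisation of the surgered spheres by Morse counts, and the induction.

## References

* J. Schultens, *Introduction to 3-Manifolds*, GSM 151, AMS (2014), Lemma 3.2.3 and proof of
  Thm. 3.2.5 (PDF pp. 42–45 of the held copy `book:schultens2014-introduction-3-manifolds`).
  [Schultens2014]
* M. W. Hirsch, *Differential Topology*, GTM 33 (1976), Ch. 8 §3, Thm. 3.1 (disc theorem).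
  [HirschDT1976]
* J. Cerf, *Sur les difféomorphismes de la sphère de dimension trois (Γ₄ = 0)*, LNM 53 (1968),
  Ch. I §1, Lemme 2 (radial extension). [CerfDiffeoSphere1968]
-/

open scoped Manifold ContDiff Topology RealInnerProductSpace
open Set Function Metric Module

noncomputable section

namespace Literature.Topology.FourManifolds

namespace BallFaceAlignment

/-! ### §1 A smoothly embedded ball is the image of the round ball under a global diffeomorphism -/

/-- **Upgrading a ball embedding to an ambient diffeomorphism.** For a smooth embedding
`e : ℝᵐ → ℝᵐ` (`m ≥ 1`) there is a diffeomorphism `Φ` of `ℝᵐ`, diffeotopic to the identity,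
with `Φ(𝔻ᵐ) = e(𝔻ᵐ)`, `Φ(𝕊ᵐ⁻¹) = e(𝕊ᵐ⁻¹)`, `Φ(𝔹ᵐ) = e(𝔹ᵐ)`: the disc theorem
(`exists_isDiffeotopicToId_apply_disc_eq`, Palais 1960 / Hirsch Ch. 8 §3 Thm. 3.1) for the discs
`id` and `e` (precomposed with a reflection when `e` reverses orientation). [folklore] -/
theorem exists_diffeomorph_image_closedBall_eq {m : ℕ} (hm : m ≠ 0)
    {e : EuclideanSpace ℝ (Fin m) → EuclideanSpace ℝ (Fin m)}
    (he : Manifold.IsSmoothEmbedding 𝓘(ℝ, EuclideanSpace ℝ (Fin m))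
      𝓘(ℝ, EuclideanSpace ℝ (Fin m)) ∞ e) :
    ∃ Φ : EuclideanSpace ℝ (Fin m) ≃ₘ⟮𝓘(ℝ, EuclideanSpace ℝ (Fin m)),
        𝓘(ℝ, EuclideanSpace ℝ (Fin m))⟯ EuclideanSpace ℝ (Fin m),
      Diffeomorph.IsDiffeotopicToId Φ ∧
      Φ '' closedBall 0 1 = e '' closedBall 0 1 ∧ Φ '' sphere 0 1 = e '' sphere 0 1 ∧
      Φ '' ball 0 1 = e '' ball 0 1 := by
  have ho : IsOpen (range e) := (he.isLocalDiffeomorph_of_finrank_eq rfl).isOpen_range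
  set o₀ := euclideanOrientation m with ho₀
  -- make `e` orientation preserving by a reflection if necessary
  obtain ⟨R, hR⟩ : ∃ R : EuclideanSpace ℝ (Fin m) ≃ₗᵢ[ℝ] EuclideanSpace ℝ (Fin m),
      IsOrientationPreserving (SmoothOrientation.modelSpace o₀)
        (SmoothOrientation.modelSpace o₀) (e ∘ R) := by
    rcases isOrientationPreserving_or_isOrientationReversing_disc he ho o₀
      (SmoothOrientation.modelSpace o₀) with h | h
    · exact ⟨LinearIsometryEquiv.refl ℝ _, by simpa using h⟩
    · obtain ⟨R, hR⟩ := exists_linearIsometryEquiv_det_eq_neg_one hm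
      refine ⟨R, ?_⟩
      have h' : IsOrientationPreserving (SmoothOrientation.modelSpace (-o₀))
          (SmoothOrientation.modelSpace o₀) e := by
        rw [← SmoothOrientation.neg_modelSpace, ← isOrientationReversing_iff_neg]; exact h
      have h2 := isOrientationReversing_disc_comp he ho h' R (by rw [hR]; norm_num)
      rwa [isOrientationReversing_iff_neg, ← SmoothOrientation.neg_modelSpace, neg_neg] at h2
  have hi' : Manifold.IsSmoothEmbedding 𝓘(ℝ, EuclideanSpace ℝ (Fin m))
      𝓘(ℝ, EuclideanSpace ℝ (Fin m)) ∞ (e ∘ R) := by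
    have h1 := he.comp_diffeomorph R.toContinuousLinearEquiv.toDiffeomorph
    have h2 : (e ∘ ⇑(R.toContinuousLinearEquiv.toDiffeomorph)) = e ∘ R := by
      funext y; simp
    rwa [h2] at h1
  obtain ⟨f, hf, hfy⟩ := exists_isDiffeotopicToId_apply_disc_eq (M := EuclideanSpace ℝ (Fin m))
    Manifold.IsSmoothEmbedding.id hi' (isOrientationPreserving_id _) hR
  have key : ∀ s : Set (EuclideanSpace ℝ (Fin m)), s ⊆ closedBall 0 1 → R '' s = s →
      f '' s = e '' s := by
    intro s hs hRs
    calc f '' s = (e ∘ R) '' s := image_congr fun y hy =>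
            hfy y (mem_closedBall_zero_iff.1 (hs hy))
      _ = e '' (R '' s) := image_comp e R s
      _ = e '' s := by rw [hRs]
  refine ⟨f, hf, key _ Subset.rfl ?_, key _ sphere_subset_closedBall ?_,
    key _ ball_subset_closedBall ?_⟩
  · simp [R.image_closedBall 0 1]
  · simp [R.image_sphere 0 1]
  · simp [R.image_ball 0 1]

/-! ### §2 Aligning two discs in the boundary sphere by a norm-preserving diffeomorphism -/

/-- **Two smooth discs in `𝕊ⁿ` are interchanged by a norm-preserving diffeomorphism of
`ℝⁿ⁺¹`.** For smooth embeddings `i, i' : ℝⁿ → 𝕊ⁿ` (`n ≥ 1`) there is a diffeomorphism `R` of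
`ℝⁿ⁺¹` with `‖R x‖ = ‖x‖` (so `R(𝔻ⁿ⁺¹) = 𝔻ⁿ⁺¹`, `R(𝕊ⁿ) = 𝕊ⁿ`) carrying the closed disc
`i(𝔻ⁿ)` onto `i'(𝔻ⁿ)`: the disc theorem in the connected manifold `𝕊ⁿ`
(`exists_isDiffeotopicToId_apply_disc_eq`; orientations matched by a reflection of `ℝⁿ`) gives
`f ∈ Diff(𝕊ⁿ)` diffeotopic to the identity with `f ∘ i = i'` on `𝔻ⁿ`, and the radial extension
of the diffeotopy (`Diffeotopy.radialExtension`, Cerf 1968, Ch. I §1, Lemme 2) is `R`.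
[cite: HirschDT1976, Ch. 8 §3, Thm. 3.1] -/
theorem exists_diffeomorph_norm_eq_image_eq {n : ℕ} (hn : n ≠ 0)
    {i i' : EuclideanSpace ℝ (Fin n) → sphere (0 : EuclideanSpace ℝ (Fin (n + 1))) 1}
    (hi : Manifold.IsSmoothEmbedding 𝓘(ℝ, EuclideanSpace ℝ (Fin n)) (𝓡 n) ∞ i)
    (hi' : Manifold.IsSmoothEmbedding 𝓘(ℝ, EuclideanSpace ℝ (Fin n)) (𝓡 n) ∞ i') :
    ∃ R : EuclideanSpace ℝ (Fin (n + 1)) ≃ₘ⟮𝓘(ℝ, EuclideanSpace ℝ (Fin (n + 1))),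
        𝓘(ℝ, EuclideanSpace ℝ (Fin (n + 1)))⟯ EuclideanSpace ℝ (Fin (n + 1)),
      (∀ x, ‖R x‖ = ‖x‖) ∧
      R '' ((↑) '' (i '' closedBall (0 : EuclideanSpace ℝ (Fin n)) 1)) =
        (↑) '' (i' '' closedBall (0 : EuclideanSpace ℝ (Fin n)) 1) := by
  haveI : ConnectedSpace (sphere (0 : EuclideanSpace ℝ (Fin (n + 1))) 1) := by
    refine isConnected_iff_connectedSpace.mp (isConnected_sphere ?_ 0 zero_le_one)
    rw [← Module.finrank_eq_rank, finrank_euclideanSpace_fin]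
    exact_mod_cast Nat.lt_add_of_pos_left (Nat.pos_of_ne_zero hn)
  obtain ⟨oM⟩ := (isOrientable_sphere_holds n :
    Nonempty (SmoothOrientation (𝓡 n) (sphere (0 : EuclideanSpace ℝ (Fin (n + 1))) 1)))
  have hio : IsOpen (range i) := (hi.isLocalDiffeomorph_of_finrank_eq rfl).isOpen_range
  have hio' : IsOpen (range i') := (hi'.isLocalDiffeomorph_of_finrank_eq rfl).isOpen_range
  obtain ⟨o₀, ho⟩ := exists_isOrientationPreserving_disc hi hio oM
  -- make `i'` orientation preserving by a reflection if necessary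
  obtain ⟨L, hL⟩ : ∃ L : EuclideanSpace ℝ (Fin n) ≃ₗᵢ[ℝ] EuclideanSpace ℝ (Fin n),
      IsOrientationPreserving (SmoothOrientation.modelSpace o₀) oM (i' ∘ L) := by
    rcases isOrientationPreserving_or_isOrientationReversing_disc hi' hio' o₀ oM with h | h
    · exact ⟨LinearIsometryEquiv.refl ℝ _, by simpa using h⟩
    · obtain ⟨L, hL⟩ := exists_linearIsometryEquiv_det_eq_neg_one hn
      refine ⟨L, ?_⟩
      have h' : IsOrientationPreserving (SmoothOrientation.modelSpace (-o₀)) oM i' := by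
        rw [← SmoothOrientation.neg_modelSpace, ← isOrientationReversing_iff_neg]; exact h
      have h2 := isOrientationReversing_disc_comp hi' hio' h' L (by rw [hL]; norm_num)
      rwa [isOrientationReversing_iff_neg, ← SmoothOrientation.neg_modelSpace, neg_neg] at h2
  have hi'' : Manifold.IsSmoothEmbedding 𝓘(ℝ, EuclideanSpace ℝ (Fin n)) (𝓡 n) ∞ (i' ∘ L) := by
    have h1 := hi'.comp_diffeomorph L.toContinuousLinearEquiv.toDiffeomorph
    have h2 : (i' ∘ ⇑(L.toContinuousLinearEquiv.toDiffeomorph)) = i' ∘ L := by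
      funext y; simp
    rwa [h2] at h1
  obtain ⟨f, ⟨D, hD⟩, hfy⟩ := exists_isDiffeotopicToId_apply_disc_eq hi hi'' ho hL
  refine ⟨D.radialExtension, fun x => by simp, ?_⟩
  have hDf : ∀ z, D.toFun 1 z = f z := fun z => by rw [← Diffeotopy.coe_stage, hD]
  rw [image_image, image_image, image_image]
  calc (fun y => D.radialExtension ((i y : sphere (0 : EuclideanSpace ℝ (Fin (n + 1))) 1) :
          EuclideanSpace ℝ (Fin (n + 1)))) '' closedBall 0 1
        = (fun y => (((i' ∘ L) y : sphere (0 : EuclideanSpace ℝ (Fin (n + 1))) 1) :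
            EuclideanSpace ℝ (Fin (n + 1)))) '' closedBall 0 1 := by
          refine image_congr fun y hy => ?_
          rw [Diffeotopy.coe_radialExtension, radialExtensionFun_coe_sphere, hDf,
            hfy y (mem_closedBall_zero_iff.1 hy)]
    _ = (fun y => ((i' y : sphere (0 : EuclideanSpace ℝ (Fin (n + 1))) 1) :
            EuclideanSpace ℝ (Fin (n + 1)))) '' (L '' closedBall 0 1) := by
          rw [image_image]; rfl
    _ = _ := by rw [L.image_closedBall 0 1]; simp

/-! ### §3 Round caps are smooth discs -/

/-- **The height of the inverse stereographic chart.** For the chart of Mathlib's sphere at `u`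
(stereographic projection from `-u`), `⟪u, σ⁻¹(z)⟫ = (4 - ‖z‖²)/(4 + ‖z‖²)`
(`stereographic'_symm_apply`). [folklore] -/
theorem inner_chartAt_symm {n : ℕ} (u : sphere (0 : EuclideanSpace ℝ (Fin (n + 1))) 1)
    (z : EuclideanSpace ℝ (Fin n)) :
    ⟪(u : EuclideanSpace ℝ (Fin (n + 1))),
      (((chartAt (EuclideanSpace ℝ (Fin n)) u).symm z :
        sphere (0 : EuclideanSpace ℝ (Fin (n + 1))) 1) : EuclideanSpace ℝ (Fin (n + 1)))⟫ =
      (4 - ‖z‖ ^ 2) / (4 + ‖z‖ ^ 2) := by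
  haveI : Fact (finrank ℝ (EuclideanSpace ℝ (Fin (n + 1))) = n + 1) := ⟨finrank_euclideanSpace_fin⟩
  have h : chartAt (EuclideanSpace ℝ (Fin n)) u = stereographic' n (-u) := rfl
  rw [h, stereographic'_symm_apply]
  dsimp only
  set U := (OrthonormalBasis.fromOrthogonalSpanSingleton (𝕜 := ℝ) n
    (ne_zero_of_mem_unit_sphere (-u))).repr with hU
  have hw : ‖(U.symm z : EuclideanSpace ℝ (Fin (n + 1)))‖ = ‖z‖ := by
    rw [Submodule.norm_coe, LinearIsometryEquiv.norm_map]
  have h1 : ⟪(((-u : sphere (0 : EuclideanSpace ℝ (Fin (n + 1))) 1)) : EuclideanSpace ℝ (Fin (n + 1))),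
      (U.symm z : EuclideanSpace ℝ (Fin (n + 1)))⟫ = 0 :=
    Submodule.mem_orthogonal_singleton_iff_inner_right.mp (U.symm z).2
  have hwu : ⟪(u : EuclideanSpace ℝ (Fin (n + 1))),
      (U.symm z : EuclideanSpace ℝ (Fin (n + 1)))⟫ = 0 := by
    have h2 : ⟪(u : EuclideanSpace ℝ (Fin (n + 1))), (U.symm z : EuclideanSpace ℝ (Fin (n + 1)))⟫ =
        -⟪-(u : EuclideanSpace ℝ (Fin (n + 1))), (U.symm z : EuclideanSpace ℝ (Fin (n + 1)))⟫ := by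
      rw [inner_neg_left, neg_neg]
    rw [h2, show -(u : EuclideanSpace ℝ (Fin (n + 1))) =
      (((-u : sphere (0 : EuclideanSpace ℝ (Fin (n + 1))) 1)) : EuclideanSpace ℝ (Fin (n + 1)))
      from (coe_neg_sphere u).symm, h1, neg_zero]
  have hu' : ⟪(u : EuclideanSpace ℝ (Fin (n + 1))),
      (-u : sphere (0 : EuclideanSpace ℝ (Fin (n + 1))) 1).val⟫ = -1 := by
    rw [show (-u : sphere (0 : EuclideanSpace ℝ (Fin (n + 1))) 1).val =
      -(u : EuclideanSpace ℝ (Fin (n + 1))) from coe_neg_sphere u, inner_neg_right,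
      real_inner_self_eq_norm_sq, norm_eq_of_mem_sphere, one_pow]
  rw [inner_add_right, inner_smul_right, inner_smul_right, hwu, inner_smul_right,
    inner_smul_right, hu', hw]
  have hq : (‖z‖ ^ 2 + 4) ≠ 0 := by positivity
  field_simp
  ring

/-- **Round caps are smooth discs.** For `u ∈ 𝕊ⁿ` and `-1 < c₀ < 1` the closed cap
`{x ∈ 𝕊ⁿ : ⟪u, x⟫ ≥ c₀}` is `i₀(𝔻ⁿ)` for a smooth embedding `i₀ : ℝⁿ → 𝕊ⁿ` of the whole model
space, namely the inverse of the stereographic chart at `u` precomposed with the homothety of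
ratio `ρ₀ = 2√((1 - c₀)/(1 + c₀))`. [folklore] -/
theorem exists_isSmoothEmbedding_image_eq_cap {n : ℕ}
    (u : sphere (0 : EuclideanSpace ℝ (Fin (n + 1))) 1) {c₀ : ℝ} (hc₀ : -1 < c₀) (hc₁ : c₀ < 1) :
    ∃ i₀ : EuclideanSpace ℝ (Fin n) → sphere (0 : EuclideanSpace ℝ (Fin (n + 1))) 1,
      Manifold.IsSmoothEmbedding 𝓘(ℝ, EuclideanSpace ℝ (Fin n)) (𝓡 n) ∞ i₀ ∧
      (↑) '' (i₀ '' closedBall (0 : EuclideanSpace ℝ (Fin n)) 1) =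
        {x : EuclideanSpace ℝ (Fin (n + 1)) |
          ‖x‖ = 1 ∧ c₀ ≤ ⟪(u : EuclideanSpace ℝ (Fin (n + 1))), x⟫} := by
  have h1c : 0 < 1 + c₀ := by linarith
  have h1c' : 0 < 1 - c₀ := by linarith
  set k : ℝ := (1 - c₀) / (1 + c₀) with hk
  have hkpos : 0 < k := div_pos h1c' h1c
  have hk1 : k * (1 + c₀) = 1 - c₀ := div_mul_cancel₀ _ h1c.ne'
  set ρ₀ : ℝ := 2 * Real.sqrt k with hρ₀
  have hρ₀pos : 0 < ρ₀ := mul_pos two_pos (Real.sqrt_pos.2 hkpos)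
  have hρ₀sq : ρ₀ ^ 2 = 4 * k := by
    rw [hρ₀, mul_pow, Real.sq_sqrt hkpos.le]; norm_num
  -- the homothety as a diffeomorphism
  let S : EuclideanSpace ℝ (Fin n) ≃ₘ⟮𝓘(ℝ, EuclideanSpace ℝ (Fin n)),
      𝓘(ℝ, EuclideanSpace ℝ (Fin n))⟯ EuclideanSpace ℝ (Fin n) :=
    { toFun := fun y => ρ₀ • y
      invFun := fun y => ρ₀⁻¹ • y
      left_inv := fun y => by simp [smul_smul, hρ₀pos.ne']
      right_inv := fun y => by simp [smul_smul, hρ₀pos.ne']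
      contMDiff_toFun := (contDiff_const_smul ρ₀).contMDiff
      contMDiff_invFun := (contDiff_const_smul ρ₀⁻¹).contMDiff }
  have hS : ∀ y, S y = ρ₀ • y := fun _ => rfl
  haveI : Fact (finrank ℝ (EuclideanSpace ℝ (Fin (n + 1))) = n + 1) := ⟨finrank_euclideanSpace_fin⟩
  set c := chartAt (EuclideanSpace ℝ (Fin n)) u with hc
  have hceq : c = stereographic' n (-u) := rfl
  have hct : c.target = univ := by rw [hceq, stereographic'_target]
  have hcs : c.source = {-u}ᶜ := by rw [hceq, stereographic'_source]
  have hemb : Manifold.IsSmoothEmbedding (𝓡 n) (𝓡 n) ∞ c.symm :=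
    isSmoothEmbedding_symm_of_target_eq_univ (IsManifold.chart_mem_maximalAtlas u) hct
  have hi₀ : Manifold.IsSmoothEmbedding 𝓘(ℝ, EuclideanSpace ℝ (Fin n)) (𝓡 n) ∞ (c.symm ∘ S) :=
    hemb.comp_diffeomorph S
  -- the key equivalence
  have key : ∀ y : EuclideanSpace ℝ (Fin n),
      c₀ ≤ ⟪(u : EuclideanSpace ℝ (Fin (n + 1))),
        ((c.symm (ρ₀ • y) : sphere (0 : EuclideanSpace ℝ (Fin (n + 1))) 1) :
          EuclideanSpace ℝ (Fin (n + 1)))⟫ ↔ ‖y‖ ≤ 1 := by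
    intro y
    rw [hc, inner_chartAt_symm, norm_smul, Real.norm_eq_abs, abs_of_pos hρ₀pos, mul_pow, hρ₀sq]
    have hq : 0 < 4 + 4 * k * ‖y‖ ^ 2 := by positivity
    rw [le_div_iff₀ hq, ← sq_le_one_iff₀ (norm_nonneg y)]
    have hkt : k * ‖y‖ ^ 2 * (1 + c₀) = ‖y‖ ^ 2 * (1 - c₀) := by
      rw [mul_comm k, mul_assoc, hk1]
    constructor
    · intro h
      -- `c₀ (4 + 4 k t) ≤ 4 - 4 k t` gives `4 k t (1 + c₀) ≤ 4 (1 - c₀)`, i.e. `t (1 - c₀) ≤ 1 - c₀`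
      have h2 : ‖y‖ ^ 2 * (1 - c₀) ≤ 1 * (1 - c₀) := by nlinarith
      exact le_of_mul_le_mul_right h2 h1c'
    · intro h
      have h2 : ‖y‖ ^ 2 * (1 - c₀) ≤ 1 * (1 - c₀) := mul_le_mul_of_nonneg_right h h1c'.le
      nlinarith
  refine ⟨c.symm ∘ S, hi₀, ?_⟩
  apply Subset.antisymm
  · rintro x ⟨x', ⟨y, hy, rfl⟩, rfl⟩
    refine ⟨by simp [norm_eq_of_mem_sphere], ?_⟩
    rw [comp_apply, hS]
    exact (key y).2 (mem_closedBall_zero_iff.1 hy)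
  · rintro x ⟨hx1, hxc⟩
    have hxs : x ∈ sphere (0 : EuclideanSpace ℝ (Fin (n + 1))) 1 := by simpa using hx1
    set xs : sphere (0 : EuclideanSpace ℝ (Fin (n + 1))) 1 := ⟨x, hxs⟩ with hxs_def
    have hne : xs ≠ -u := by
      intro h
      have h' : x = -(u : EuclideanSpace ℝ (Fin (n + 1))) := by
        rw [← coe_neg_sphere, ← h]
      rw [h', inner_neg_right, real_inner_self_eq_norm_sq, norm_eq_of_mem_sphere, one_pow] at hxc
      linarith
    have hsrc : xs ∈ c.source := by rw [hcs]; exact hne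
    set y : EuclideanSpace ℝ (Fin n) := ρ₀⁻¹ • c xs with hy
    have hyx : c.symm (ρ₀ • y) = xs := by
      rw [hy, smul_smul, mul_inv_cancel₀ hρ₀pos.ne', one_smul, c.left_inv hsrc]
    refine ⟨xs, ⟨y, ?_, ?_⟩, rfl⟩
    · rw [mem_closedBall_zero_iff, ← key y, hyx]
      exact hxc
    · rw [comp_apply, hS, hyx]

/-! ### §4 Lifting a disc on an embedded sphere to the abstract sphere -/

/-- **Lifting a disc through a diffeomorphism onto the sphere.** If `Φ` is a diffeomorphism of
`ℝⁿ⁺¹` and `j : ℝⁿ → ℝⁿ⁺¹` a smooth embedding with `j(ℝⁿ) ⊆ Φ(𝕊ⁿ)`, then `j = Φ ∘ i'` for a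
smooth embedding `i' : ℝⁿ → 𝕊ⁿ` into Mathlib's sphere (`i' = Φ⁻¹ ∘ j` read in `𝕊ⁿ`:
`ContMDiff.codRestrict_sphere`, injective differential by the chain rule, immersion by the
criterion `isImmersion_of_injective_mfderiv`). Lee (2013), Thm. 5.27 / Cor. 5.30 (restricting
the codomain to an embedded submanifold). [folklore] -/
theorem exists_lift_disc {n : ℕ}
    (Φ : EuclideanSpace ℝ (Fin (n + 1)) ≃ₘ⟮𝓘(ℝ, EuclideanSpace ℝ (Fin (n + 1))),
      𝓘(ℝ, EuclideanSpace ℝ (Fin (n + 1)))⟯ EuclideanSpace ℝ (Fin (n + 1)))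
    {j : EuclideanSpace ℝ (Fin n) → EuclideanSpace ℝ (Fin (n + 1))}
    (hj : Manifold.IsSmoothEmbedding 𝓘(ℝ, EuclideanSpace ℝ (Fin n))
      𝓘(ℝ, EuclideanSpace ℝ (Fin (n + 1))) ∞ j)
    (hjΦ : range j ⊆ Φ '' sphere 0 1) :
    ∃ i' : EuclideanSpace ℝ (Fin n) → sphere (0 : EuclideanSpace ℝ (Fin (n + 1))) 1,
      Manifold.IsSmoothEmbedding 𝓘(ℝ, EuclideanSpace ℝ (Fin n)) (𝓡 n) ∞ i' ∧
      ∀ y, Φ (i' y) = j y := by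
  set g : EuclideanSpace ℝ (Fin n) → EuclideanSpace ℝ (Fin (n + 1)) := fun y => Φ.symm (j y)
    with hg
  have hgs : ∀ y, g y ∈ sphere (0 : EuclideanSpace ℝ (Fin (n + 1))) 1 := fun y => by
    obtain ⟨z, hz, hzy⟩ := hjΦ ⟨y, rfl⟩
    rw [hg]; dsimp only; rw [← hzy, Diffeomorph.symm_apply_apply]; exact hz
  have hgc : ContMDiff 𝓘(ℝ, EuclideanSpace ℝ (Fin n)) 𝓘(ℝ, EuclideanSpace ℝ (Fin (n + 1))) ∞ g :=
    Φ.symm.contMDiff.comp hj.contMDiff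
  haveI : Fact (finrank ℝ (EuclideanSpace ℝ (Fin (n + 1))) = n + 1) := ⟨finrank_euclideanSpace_fin⟩
  set i' : EuclideanSpace ℝ (Fin n) → sphere (0 : EuclideanSpace ℝ (Fin (n + 1))) 1 :=
    Set.codRestrict g _ hgs with hi'
  have hi'c : ContMDiff 𝓘(ℝ, EuclideanSpace ℝ (Fin n)) (𝓡 n) ∞ i' := hgc.codRestrict_sphere hgs
  have e2 : g = (↑) ∘ i' := rfl
  have e1 : j = Φ ∘ g := by funext y; simp [hg]
  -- injective differential
  have hinj : ∀ y, Injective (mfderiv 𝓘(ℝ, EuclideanSpace ℝ (Fin n)) (𝓡 n) i' y) := by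
    intro y
    have hgd : MDifferentiableAt 𝓘(ℝ, EuclideanSpace ℝ (Fin n))
        𝓘(ℝ, EuclideanSpace ℝ (Fin (n + 1))) g y := (hgc y).mdifferentiableAt (by simp)
    have hΦd : MDifferentiableAt 𝓘(ℝ, EuclideanSpace ℝ (Fin (n + 1)))
        𝓘(ℝ, EuclideanSpace ℝ (Fin (n + 1))) Φ (g y) := (Φ.contMDiff (g y)).mdifferentiableAt (by simp)
    have hi'd : MDifferentiableAt 𝓘(ℝ, EuclideanSpace ℝ (Fin n)) (𝓡 n) i' y :=
      (hi'c y).mdifferentiableAt (by simp)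
    have hcd : MDifferentiableAt (𝓡 n) 𝓘(ℝ, EuclideanSpace ℝ (Fin (n + 1)))
        ((↑) : sphere (0 : EuclideanSpace ℝ (Fin (n + 1))) 1 → EuclideanSpace ℝ (Fin (n + 1)))
        (i' y) := (contMDiff_coe_sphere (m := ∞) (i' y)).mdifferentiableAt (by simp)
    have h1 : Injective (mfderiv 𝓘(ℝ, EuclideanSpace ℝ (Fin n))
        𝓘(ℝ, EuclideanSpace ℝ (Fin (n + 1))) g y) := by
      have h := injective_mfderiv_of_isImmersionAt' (hj.isImmersion.isImmersionAt y)
      rw [e1, mfderiv_comp y hΦd hgd] at h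
      exact Injective.of_comp h
    rw [e2, mfderiv_comp y hcd hi'd] at h1
    exact Injective.of_comp h1
  have himm : Manifold.IsImmersion 𝓘(ℝ, EuclideanSpace ℝ (Fin n)) (𝓡 n) ∞ i' :=
    isImmersion_of_injective_mfderiv hi'c (by simp) hinj
  have hemb : Topology.IsEmbedding i' := by
    rw [← Topology.IsEmbedding.subtypeVal.of_comp_iff, ← e2]
    exact Φ.symm.toHomeomorph.isEmbedding.comp hj.isEmbedding
  refine ⟨i', ⟨himm, hemb⟩, fun y => ?_⟩
  rw [show ((i' y : sphere (0 : EuclideanSpace ℝ (Fin (n + 1))) 1) :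
    EuclideanSpace ℝ (Fin (n + 1))) = g y from rfl, hg]
  exact Φ.apply_symm_apply _

/-! ### §5 The pair diffeomorphism: model ball with its round cap onto a ball with a given face -/

/-- **Aligning a ball-with-face pair.** Let `e : ℝⁿ⁺¹ → ℝⁿ⁺¹` be a smooth embedding (the ball
`B = e(𝔻ⁿ⁺¹)` with boundary sphere `e(𝕊ⁿ)`), `j : ℝⁿ → ℝⁿ⁺¹` a smooth embedding with
`j(ℝⁿ) ⊆ e(𝕊ⁿ)` (the face `D = j(𝔻ⁿ) ⊆ ∂B`), `Ψ` any diffeomorphism of `ℝⁿ⁺¹` (the model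
presentation `M₀ = Ψ(𝔻ⁿ⁺¹)`), `u ∈ 𝕊ⁿ`, `-1 < c₀ < 1` (the model face `Ψ` of the round cap
`{⟪u, ·⟫ ≥ c₀}`), `n ≥ 1`. Then some diffeomorphism `Θ` of `ℝⁿ⁺¹` carries `Ψ(𝔻ⁿ⁺¹)` onto `B`,
`Ψ(𝕊ⁿ)` onto `∂B`, `Ψ(𝔹ⁿ⁺¹)` onto `e(𝔹ⁿ⁺¹)` and the model face onto `D`:
`Θ = Φ ∘ R ∘ Ψ⁻¹` with `Φ` from `exists_diffeomorph_image_closedBall_eq` and `R` from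
`exists_diffeomorph_norm_eq_image_eq` applied to the round cap (a disc,
`exists_isSmoothEmbedding_image_eq_cap`) and the lift of `j` (`exists_lift_disc`). This is the
"standard model of a neighbourhood of the ball" in Schultens' Lemma 3.2.3 (2014, PDF p. 43),
with the disc `D` in its boundary straightened. [cite: Schultens2014, Lemma 3.2.3 (PDF pp. 42–43)] -/
theorem exists_diffeomorph_image_model_eq {n : ℕ} (hn : n ≠ 0)
    {e : EuclideanSpace ℝ (Fin (n + 1)) → EuclideanSpace ℝ (Fin (n + 1))}
    (he : Manifold.IsSmoothEmbedding 𝓘(ℝ, EuclideanSpace ℝ (Fin (n + 1)))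
      𝓘(ℝ, EuclideanSpace ℝ (Fin (n + 1))) ∞ e)
    {j : EuclideanSpace ℝ (Fin n) → EuclideanSpace ℝ (Fin (n + 1))}
    (hj : Manifold.IsSmoothEmbedding 𝓘(ℝ, EuclideanSpace ℝ (Fin n))
      𝓘(ℝ, EuclideanSpace ℝ (Fin (n + 1))) ∞ j)
    (hje : range j ⊆ e '' sphere 0 1)
    (Ψ : EuclideanSpace ℝ (Fin (n + 1)) ≃ₘ⟮𝓘(ℝ, EuclideanSpace ℝ (Fin (n + 1))),
      𝓘(ℝ, EuclideanSpace ℝ (Fin (n + 1)))⟯ EuclideanSpace ℝ (Fin (n + 1)))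
    (u : sphere (0 : EuclideanSpace ℝ (Fin (n + 1))) 1) {c₀ : ℝ} (hc₀ : -1 < c₀) (hc₁ : c₀ < 1) :
    ∃ Θ : EuclideanSpace ℝ (Fin (n + 1)) ≃ₘ⟮𝓘(ℝ, EuclideanSpace ℝ (Fin (n + 1))),
        𝓘(ℝ, EuclideanSpace ℝ (Fin (n + 1)))⟯ EuclideanSpace ℝ (Fin (n + 1)),
      Θ '' (Ψ '' closedBall 0 1) = e '' closedBall 0 1 ∧
      Θ '' (Ψ '' sphere 0 1) = e '' sphere 0 1 ∧
      Θ '' (Ψ '' ball 0 1) = e '' ball 0 1 ∧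
      Θ '' (Ψ '' {x | ‖x‖ = 1 ∧ c₀ ≤ ⟪(u : EuclideanSpace ℝ (Fin (n + 1))), x⟫}) =
        j '' closedBall 0 1 := by
  obtain ⟨Φ, -, hΦD, hΦS, hΦB⟩ := exists_diffeomorph_image_closedBall_eq (Nat.succ_ne_zero n) he
  obtain ⟨i', hi', hi'j⟩ := exists_lift_disc Φ hj (hΦS.symm ▸ hje)
  obtain ⟨i₀, hi₀, hi₀cap⟩ := exists_isSmoothEmbedding_image_eq_cap u hc₀ hc₁
  obtain ⟨R, hRn, hRcap⟩ := exists_diffeomorph_norm_eq_image_eq hn hi₀ hi'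
  have hcomp : ∀ s : Set (EuclideanSpace ℝ (Fin (n + 1))),
      (Ψ.symm.trans (R.trans Φ)) '' (Ψ '' s) = Φ '' (R '' s) := fun s => by
    rw [image_image, image_image]
    refine image_congr fun y _ => ?_
    simp [Diffeomorph.coe_trans]
  have hRimg : ∀ s : Set (EuclideanSpace ℝ (Fin (n + 1))), (∀ x, x ∈ s ↔ R x ∈ s) →
      R '' s = s := fun s hs => by
    ext x; constructor
    · rintro ⟨y, hy, rfl⟩; exact (hs y).1 hy
    · intro hx
      exact ⟨R.symm x, (hs _).2 (by rwa [Diffeomorph.apply_symm_apply]), R.apply_symm_apply x⟩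
  refine ⟨Ψ.symm.trans (R.trans Φ), ?_, ?_, ?_, ?_⟩
  · rw [hcomp, hRimg _ fun x => by rw [mem_closedBall_zero_iff, mem_closedBall_zero_iff, hRn],
      hΦD]
  · rw [hcomp, hRimg _ fun x => by rw [mem_sphere_zero_iff_norm, mem_sphere_zero_iff_norm, hRn],
      hΦS]
  · rw [hcomp, hRimg _ fun x => by rw [mem_ball_zero_iff, mem_ball_zero_iff, hRn], hΦB]
  · rw [hcomp, ← hi₀cap, hRcap, image_image, image_image]
    exact image_congr fun y _ => hi'j y

/-! ### §6 The model face of `FlatFaceModel` is the image of the round cap -/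

/-- **The flat face is the sheared round cap.** For the shear `Ψ x = x - s(x) u` of
`FlatFaceModel.exists_model` (`‖u‖ = 1`, `0 < r₀ < 1`, `s = √(1 - hsq) - √(1 - r₀²)` on
`{hsq ≤ r₀²}`, `hsq x = ‖x‖² - ⟪u, x⟫²`, `s` invariant under `x ↦ x + t u`), the flat face
`F₀ = {⟪u, x⟫ = √(1 - r₀²), hsq x ≤ r₀²}` of the model body `M₀ = Ψ(𝔻)` is the image under `Ψ`
of the round cap `{x ∈ 𝕊 : ⟪u, x⟫ ≥ √(1 - r₀²)}`. [folklore] -/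
theorem image_cap_eq_face {E : Type*} [NormedAddCommGroup E] [InnerProductSpace ℝ E]
    {u : E} (hu : ‖u‖ = 1) {r₀ : ℝ} (h0 : 0 < r₀) (h1 : r₀ < 1) (Ψ : E ≃ E) (s : E → ℝ)
    (hs : ∀ x, ‖x‖ ^ 2 - ⟪u, x⟫ ^ 2 ≤ r₀ ^ 2 →
      s x = Real.sqrt (1 - (‖x‖ ^ 2 - ⟪u, x⟫ ^ 2)) - Real.sqrt (1 - r₀ ^ 2))
    (hΨ : ∀ x, Ψ x = x - s x • u) (hΨ' : ∀ x, Ψ.symm x = x + s x • u) :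
    Ψ '' {x | ‖x‖ = 1 ∧ Real.sqrt (1 - r₀ ^ 2) ≤ ⟪u, x⟫} =
      {x | ⟪u, x⟫ = Real.sqrt (1 - r₀ ^ 2) ∧ ‖x‖ ^ 2 - ⟪u, x⟫ ^ 2 ≤ r₀ ^ 2} := by
  have hr0 : r₀ ^ 2 < 1 := by nlinarith
  set c₀ := Real.sqrt (1 - r₀ ^ 2) with hc₀
  have hc₀pos : 0 < c₀ := Real.sqrt_pos.2 (by linarith)
  have hc₀sq : c₀ ^ 2 = 1 - r₀ ^ 2 := Real.sq_sqrt (by linarith)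
  have huu : ⟪u, u⟫ = 1 := by rw [real_inner_self_eq_norm_sq, hu, one_pow]
  have hnorm : ∀ y : E, ‖y‖ ^ 2 = (‖y‖ ^ 2 - ⟪u, y⟫ ^ 2) + ⟪u, y⟫ ^ 2 := fun y => by ring
  apply Subset.antisymm
  · rintro x ⟨y, ⟨hy1, hyc⟩, rfl⟩
    have hy0 : 0 ≤ ⟪u, y⟫ := hc₀pos.le.trans hyc
    have hhsq : ‖y‖ ^ 2 - ⟪u, y⟫ ^ 2 ≤ r₀ ^ 2 := by rw [hy1]; nlinarith
    have hsy : s y = ⟪u, y⟫ - c₀ := by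
      rw [hs y hhsq, hy1, show (1 : ℝ) - (1 ^ 2 - ⟪u, y⟫ ^ 2) = ⟪u, y⟫ ^ 2 by ring,
        Real.sqrt_sq hy0]
    refine ⟨?_, ?_⟩
    · rw [hΨ, hsy, inner_sub_right, inner_smul_right, huu]; ring
    · have e1 : y - s y • u = y + (-s y) • u := by rw [neg_smul, sub_eq_add_neg]
      rw [hΨ, e1, FlatFaceModel.hsq_add_smul hu]; exact hhsq
  · rintro x ⟨hxc, hhsq⟩
    have hsx : s x = Real.sqrt (1 - (‖x‖ ^ 2 - ⟪u, x⟫ ^ 2)) - c₀ := hs x hhsq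
    have h1q : 0 ≤ 1 - (‖x‖ ^ 2 - ⟪u, x⟫ ^ 2) := by linarith
    refine ⟨Ψ.symm x, ⟨?_, ?_⟩, Ψ.apply_symm_apply x⟩
    · have hy : ⟪u, Ψ.symm x⟫ = Real.sqrt (1 - (‖x‖ ^ 2 - ⟪u, x⟫ ^ 2)) := by
        rw [hΨ', inner_add_right, inner_smul_right, huu, hsx, hxc]; ring
      have hq : ‖Ψ.symm x‖ ^ 2 - ⟪u, Ψ.symm x⟫ ^ 2 = ‖x‖ ^ 2 - ⟪u, x⟫ ^ 2 := by
        rw [hΨ', FlatFaceModel.hsq_add_smul hu]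
      have hsq2 : ‖Ψ.symm x‖ ^ 2 = 1 := by
        rw [hnorm, hq, hy, Real.sq_sqrt h1q]; ring
      exact (pow_eq_one_iff_of_nonneg (norm_nonneg _) two_ne_zero).1 hsq2
    · have hle := Real.sqrt_le_sqrt (by linarith : 1 - r₀ ^ 2 ≤ 1 - (‖x‖ ^ 2 - ⟪u, x⟫ ^ 2))
      rw [hΨ', inner_add_right, inner_smul_right, huu, hsx, mul_one]
      rw [← hc₀] at hle
      linarith

end BallFaceAlignment

end Literature.Topology.FourManifolds
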